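import Summits.HodgeConjecture.HodgeCM.PerL34.LevelLattice_1

/-! PORT of `HodgeCM/PerL34/LevelLattice.lean` (HodgeCMPerL run 82) — part 2: continuation of `Summits.HodgeConjecture.HodgeCM.PerL34.LevelLattice_1` (split at a top-level declaration boundary by port_pkg.py; scope re-opened below; declarations unchanged). -/

-- port_pkg: scope re-opened for this part (file-level context, then the namespace/section stack open at the cut)
set_option autoImplicit false
noncomputable section
open scoped Pointwise MatrixGroups RestrictedProduct Matrix
open NumberField IsDedekindDomain Topology
open Literature.AlgebraicGeometry.ShimuraVarieties
open HodgeCM.Adelic HodgeCM.PerL34.AdelicUnitaryFactorisation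
namespace HodgeCM.PerL34.Godement
section Rational
variable (L : CMField) {m : ℕ}
local notation "𝔸f" => FiniteAdeleRing (𝓞 L) L
variable (H : Matrix (Fin m) (Fin m) L)
variable {L} in
/-- **Rational points of `K(n)`:** `g ∈ GL_m(L)` has finite-adelic image in `K(n)` iff `g ≡ 1` and
`g⁻¹ ≡ 1 (mod n)` integrally (`0 < n`). -/
theorem toFinGL_mem_finLevel_iff {n : ℕ} (hn : 0 < n) (g : GL (Fin m) L) :
    toFinGL L g ∈ finLevel L m n ↔
      IsCongruentOneMod n (g : Matrix (Fin m) (Fin m) L) ∧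
        IsCongruentOneMod n ((g⁻¹ : GL (Fin m) L) : Matrix (Fin m) (Fin m) L) := by
  rw [mem_finLevel_iff, ← map_inv, val_toFinGL, val_toFinGL, map_mem_finLevelSubmonoid_iff hn,
    map_mem_finLevelSubmonoid_iff hn]

/-- **The archimedean image `Γ_∞ ≤ U(H)_∞` of a subgroup `Γ ≤ GL_m(L)`** (meant for `Γ ≤ U(H)(L₀)`). -/
def archLattice (Γ : Subgroup (GL (Fin m) L)) : Subgroup (Uinf L H) :=
  (Γ.map (toInfGL L)).subgroupOf (Uinf L H)

variable {L H} in
/-- (Ported verbatim from the HodgeCMPerL package; no docstring in the source.) -/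
theorem mem_archLattice_iff {Γ : Subgroup (GL (Fin m) L)} {a : Uinf L H} :
    a ∈ archLattice L H Γ ↔ ∃ g ∈ Γ, toInfGL L g = a := by
  simp only [archLattice, Subgroup.mem_subgroupOf, Subgroup.mem_map]

variable {L H} in
/-- (Ported verbatim from the HodgeCMPerL package; no docstring in the source.) -/
theorem archLattice_mono {Γ Δ : Subgroup (GL (Fin m) L)} (h : Γ ≤ Δ) : archLattice L H Γ ≤ archLattice L H Δ :=
  fun _ ha => by
    obtain ⟨g, hg, hga⟩ := mem_archLattice_iff.mp ha
    exact mem_archLattice_iff.mpr ⟨g, h hg, hga⟩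

/-- **The bridge: `Γ_H(K_H(n)) = Γ(n)_∞`.** The adelic congruence lattice of the principal level `K_H(n)`
(row #4's `congruenceLattice`) is the archimedean image of the vendored rational principal congruence subgroup
`Γ(n) = principalCongruenceSubgroup σ H n` (`0 < n`). -/
theorem congruenceLattice_levelUfin {n : ℕ} (hn : 0 < n) :
    congruenceLattice L H (levelUfin L H n) =
      archLattice L H (principalCongruenceSubgroup (conjRingHomK L) H n) := by
  ext a
  rw [mem_congruenceLattice_iff, mem_archLattice_iff]
  constructor
  · rintro ⟨γ, hγ, hK, hγa⟩
    obtain ⟨g, hgU, hg⟩ := (mem_adelicUnitaryRat_iff L H γ).1 hγ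
    have hγ' : γ = ⟨toAdeleGL L g, toAdeleGL_mem L H hgU⟩ := Subtype.ext hg.symm
    subst hγ'
    rw [mem_levelUfin_iff, coe_splitEquiv_snd_toAdeleGL, toFinGL_mem_finLevel_iff hn] at hK
    refine ⟨g, ⟨hgU, hK.1, hK.2⟩, ?_⟩
    rw [← hγa, coe_splitEquiv_fst_toAdeleGL]
  · rintro ⟨g, ⟨hgU, hg₁, hg₂⟩, hga⟩
    refine ⟨⟨toAdeleGL L g, toAdeleGL_mem L H hgU⟩, ?_, ?_, ?_⟩
    · exact (mem_adelicUnitaryRat_iff L H _).2 ⟨g, hgU, rfl⟩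
    · rw [mem_levelUfin_iff, coe_splitEquiv_snd_toAdeleGL, toFinGL_mem_finLevel_iff hn]
      exact ⟨hg₁, hg₂⟩
    · exact Subtype.ext (by rw [coe_splitEquiv_fst_toAdeleGL, hga])

variable {H} in
/-- For `Δ ≤ U(H)(L₀)`, `g ↦ g_∞` is a group isomorphism `Δ ≃* Δ_∞`. -/
def archLatticeEquivOfLE {Δ : Subgroup (GL (Fin m) L)} (hΔ : Δ ≤ unitaryGroup (conjRingHomK L) H) :
    Δ ≃* archLattice L H Δ :=
  MulEquiv.ofBijective
    ({ toFun := fun g => ⟨⟨toInfGL L g, toInfGL_mem_Uinf L (hΔ g.2)⟩,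
         mem_archLattice_iff.mpr ⟨g, g.2, rfl⟩⟩
       map_one' := Subtype.ext (Subtype.ext (by simp))
       map_mul' := fun g h => Subtype.ext (Subtype.ext (by simp)) } : Δ →* archLattice L H Δ)
    (by
      constructor
      · intro g h hgh
        have h' := congrArg (fun x : archLattice L H Δ => ((x : Uinf L H) : GL (Fin m) (InfiniteAdeleRing L))) hgh
        exact Subtype.ext (toInfGL_injective L h')
      · rintro ⟨a, ha⟩
        obtain ⟨g, hg, hga⟩ := mem_archLattice_iff.mp ha
        exact ⟨⟨g, hg⟩, Subtype.ext (Subtype.ext hga)⟩)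

variable {H} in
/-- (Ported verbatim from the HodgeCMPerL package; no docstring in the source.) -/
@[simp] theorem coe_archLatticeEquivOfLE_apply {Δ : Subgroup (GL (Fin m) L)}
    (hΔ : Δ ≤ unitaryGroup (conjRingHomK L) H) (g : Δ) :
    (((archLatticeEquivOfLE L hΔ g : archLattice L H Δ) : Uinf L H) : GL (Fin m) (InfiniteAdeleRing L)) =
      toInfGL L g := rfl

variable {H} in
/-- Finite index passes to the archimedean images (for `Γ ≤ Δ ≤ U(H)(L₀)`). -/
theorem finiteIndex_archLattice (Γ : Subgroup (GL (Fin m) L)) {Δ : Subgroup (GL (Fin m) L)}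
    (hΔ : Δ ≤ unitaryGroup (conjRingHomK L) H) [hfi : (Γ.subgroupOf Δ).FiniteIndex] :
    ((archLattice L H Γ).subgroupOf (archLattice L H Δ)).FiniteIndex := by
  let e := archLatticeEquivOfLE L (H := H) hΔ
  have hmap : (Γ.subgroupOf Δ).map e.toMonoidHom ≤ (archLattice L H Γ).subgroupOf (archLattice L H Δ) := by
    rintro _ ⟨g, hg, rfl⟩
    have hg' : (g : GL (Fin m) L) ∈ Γ := Subgroup.mem_subgroupOf.mp hg
    exact Subgroup.mem_subgroupOf.mpr (mem_archLattice_iff.mpr ⟨(g : GL (Fin m) L), hg', rfl⟩)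
  have hdvd : ((archLattice L H Γ).subgroupOf (archLattice L H Δ)).index ∣ (Γ.subgroupOf Δ).index :=
    (Subgroup.index_dvd_of_le hmap).trans (Subgroup.index_map_dvd _ e.surjective)
  exact ⟨fun h0 => hfi.index_ne_zero (Nat.eq_zero_of_zero_dvd (h0 ▸ hdvd))⟩

end Rational

/-! ## §3 Every `Level` is a uniform torsion-free lattice in `G_U(ℝ)` -/

section LevelHeadlines

variable (L : CMField) {ι₁ : L →+* ℂ} (V : HermSpace3 L ι₁) (Λ : Level V)

/-- **`Λ.Γ ≅ Γ_∞`**: a level is isomorphic to its archimedean image in `G_U(ℝ) = Uinf L V.Hm`. -/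
def _root_.HodgeCM.Level.archLatticeEquiv : Λ.Γ ≃* archLattice L V.Hm Λ.Γ :=
  archLatticeEquivOfLE L Λ.isCongruence.1

/-- **Every level is DISCRETE in `G_U(ℝ)`** (any `V`; no degree hypothesis). -/
theorem _root_.HodgeCM.Level.discreteTopology_archLattice : DiscreteTopology (archLattice L V.Hm Λ.Γ) := by
  obtain ⟨hU, n, hn, hle, hfi⟩ := Λ.isCongruence
  haveI : DiscreteTopology (archLattice L V.Hm (principalCongruenceSubgroup (conjRingHomK L) V.Hm n)) := by
    rw [← congruenceLattice_levelUfin L V.Hm hn]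
    exact discreteTopology_congruenceLattice L V.Hm _ (isCompact_levelUfin L V.Hm n)
  haveI := finiteIndex_archLattice L (H := V.Hm) (principalCongruenceSubgroup (conjRingHomK L) V.Hm n) hU
  exact discreteTopology_of_finiteIndex (archLattice L V.Hm (principalCongruenceSubgroup (conjRingHomK L) V.Hm n))
    (archLattice L V.Hm Λ.Γ)

/-- **Every level is COCOMPACT in `G_U(ℝ)` when `[L:ℚ] ≠ 2`** (PerL v5 ll. 70–73 "projective", group level). -/
theorem _root_.HodgeCM.Level.compactSpace_quotient_archLattice (hL : Module.finrank ℚ L ≠ 2) :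
    CompactSpace (Uinf L V.Hm ⧸ archLattice L V.Hm Λ.Γ) := by
  obtain ⟨hU, n, hn, hle, hfi⟩ := Λ.isCongruence
  haveI : CompactSpace (Uinf L V.Hm ⧸ archLattice L V.Hm (principalCongruenceSubgroup (conjRingHomK L) V.Hm n)) := by
    rw [← congruenceLattice_levelUfin L V.Hm hn]
    exact HodgeCM.HermSpace3.compactSpace_quotient_congruenceLattice L V hL _ (isOpen_levelUfin L V.Hm n)
  exact compactSpace_quotient_of_le (archLattice_mono hle)

/-- **Every level is TORSION-FREE in `G_U(ℝ)`** (`GL₃(L) → GL₃(L_∞)` is injective). -/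
theorem _root_.HodgeCM.Level.torsionFree_archLattice :
    ∀ γ ∈ archLattice L V.Hm Λ.Γ, IsOfFinOrder γ → γ = 1 := by
  intro γ hγ hfin
  obtain ⟨g, hg, hgγ⟩ := mem_archLattice_iff.mp hγ
  have hfin' : IsOfFinOrder (γ : GL (Fin 3) (InfiniteAdeleRing L)) := (Uinf L V.Hm).subtype.isOfFinOrder hfin
  rw [← hgγ, (toInfGL_injective L (m := 3)).isOfFinOrder_iff] at hfin'
  have hg1 : g = 1 := Λ.torsionFree g hg hfin'
  subst hg1
  exact Subtype.ext (by rw [← hgγ, map_one]; rfl)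

/-- **PerL v5 ll. 72–73 (KERNEL, group level), for every `Λ : Level V`: `Γ_∞` acts FREELY on `G_U(ℝ)/C`** for every
compact subgroup `C ≤ G_U(ℝ)` (e.g. a maximal compact `K_∞`, `G_U(ℝ)/K_∞ = 𝔹² × pt`). -/
theorem _root_.HodgeCM.Level.stabilizer_archLattice_eq_bot (C : Subgroup (Uinf L V.Hm))
    (hC : IsCompact (C : Set (Uinf L V.Hm))) (x : Uinf L V.Hm ⧸ C) :
    MulAction.stabilizer (Uinf L V.Hm) x ⊓ archLattice L V.Hm Λ.Γ = ⊥ := by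
  haveI := HodgeCM.Level.discreteTopology_archLattice L V Λ
  exact stabilizer_inf_eq_bot_of_torsionFree (archLattice L V.Hm Λ.Γ)
    (HodgeCM.Level.torsionFree_archLattice L V Λ) C hC x

/-- (Ported verbatim from the HodgeCMPerL package; no docstring in the source.) -/
theorem _root_.HodgeCM.Level.smul_eq_self_iff (C : Subgroup (Uinf L V.Hm)) (hC : IsCompact (C : Set (Uinf L V.Hm)))
    {γ : Uinf L V.Hm} (hγ : γ ∈ archLattice L V.Hm Λ.Γ) (x : Uinf L V.Hm ⧸ C) : γ • x = x ↔ γ = 1 := by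
  haveI := HodgeCM.Level.discreteTopology_archLattice L V Λ
  exact smul_eq_self_iff_eq_one_of_torsionFree (archLattice L V.Hm Λ.Γ)
    (HodgeCM.Level.torsionFree_archLattice L V Λ) C hC hγ x

end LevelHeadlines

end HodgeCM.PerL34.Godement

end

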